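import Mathlib.Analysis.Calculus.UniformLimitsDeriv
import Mathlib.Analysis.InnerProductSpace.PiL2
import Literature.Analysis.FluidPDE.SereginSverakBlowupExtraction
import HarnessLib

/-!
# Route HardyPointSink — `HardyAncientLimit`, step 7a: derivatives of an equicontinuous limit

Support file for item stmt-NavierStokesRegularity-9138 (`HardyAncientLimit`) of route
`HardyPointSink` (problem `NavierStokesRegularity`).

A real-analysis lemma used to pass the scaled dissipation `E` to the blow-up limit:

* `HardyAncientLimit.tendsto_fderiv_of_equicontinuous` — if `f_k → g` pointwise on a ball
  `B(x, δ)` of `ℝ³`, the `f_k` are differentiable there with derivatives uniformly bounded and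
  uniformly Hölder continuous (for all large `k`), then `g` is differentiable at `x` and
  `Df_k(x) → Dg(x)`. Proof: by the subsequence principle (`Filter.tendsto_of_subseq_tendsto`) it
  suffices to extract from every subsequence a further one along which the derivatives converge to
  `Dg(x)`; Arzelà–Ascoli (the tree's `SereginSverak2009.exists_strictMono_tendstoUniformlyOn`) gives
  uniform convergence of the derivatives on `B̄(x, δ/2)` along a further subsequence, and the
  uniform limit of derivatives is the derivative of the limit (Mathlib's
  `hasFDerivAt_of_tendstoUniformlyOn`), which is unique.

## References

* W. Rudin, *Principles of Mathematical Analysis*, Thm. 7.17 (uniform convergence and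
  differentiation). [folklore]
-/

noncomputable section

open Literature.Analysis.FluidPDE Literature.Analysis.FluidPDE.SereginSverak2009
open Set Function Filter Topology Metric
open scoped NNReal

namespace Summit.NavierStokesRegularity.NavierStokesRegularity.Theorems

namespace HardyAncientLimit

/-- **Derivatives of an equicontinuous family converge to the derivative of the pointwise limit.**
Let `f_k, g : ℝ³ → ℝ³`, `x ∈ ℝ³`, `δ > 0`. Suppose that for all large `k`: `f_k` is differentiable on
`B(x, δ)` with `y ↦ Df_k(y)` continuous there, `‖Df_k(y)‖ ≤ B` and
`‖Df_k(y) − Df_k(y')‖ ≤ K |y − y'|^α` on `B(x, δ)` (`K ≥ 0`, `α > 0`); and `f_k(y) → g(y)` for every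
`y ∈ B(x, δ)`. Then `g` is differentiable at `x` and `Df_k(x) → Dg(x)`. [folklore] -/
theorem tendsto_fderiv_of_equicontinuous
    {f : ℕ → EuclideanSpace ℝ (Fin 3) → EuclideanSpace ℝ (Fin 3)}
    {g : EuclideanSpace ℝ (Fin 3) → EuclideanSpace ℝ (Fin 3)} {x : EuclideanSpace ℝ (Fin 3)}
    {δ : ℝ} (hδ : 0 < δ)
    (hdiff : ∀ᶠ k in atTop, ∀ y ∈ ball x δ, DifferentiableAt ℝ (f k) y)
    (hcontd : ∀ᶠ k in atTop, ContinuousOn (fun y => fderiv ℝ (f k) y) (ball x δ))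
    (hlim : ∀ y ∈ ball x δ, Tendsto (fun k => f k y) atTop (𝓝 (g y)))
    {B K α : ℝ} (hK : 0 ≤ K) (hα : 0 < α)
    (hbd : ∀ᶠ k in atTop, ∀ y ∈ ball x δ, ‖fderiv ℝ (f k) y‖ ≤ B)
    (hmod : ∀ᶠ k in atTop, ∀ y ∈ ball x δ, ∀ y' ∈ ball x δ,
      dist (fderiv ℝ (f k) y) (fderiv ℝ (f k) y') ≤ K * dist y y' ^ α) :
    HasFDerivAt g (fderiv ℝ g x) x ∧
      Tendsto (fun k => fderiv ℝ (f k) x) atTop (𝓝 (fderiv ℝ g x)) := by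
  set B' : ℝ := max B 1 with hB'
  have hB'1 : 1 ≤ B' := le_max_right _ _
  have hB'0 : 0 < B' := lt_of_lt_of_le one_pos hB'1
  have hBB' : B ≤ B' := le_max_left _ _
  set s : Set (EuclideanSpace ℝ (Fin 3)) := ball x (δ / 2) with hs
  set T : Set (EuclideanSpace ℝ (Fin 3)) := closedBall x (δ / 2) with hT
  have hTδ : T ⊆ ball x δ := closedBall_subset_ball (by linarith)
  have hsT : s ⊆ T := ball_subset_closedBall
  have hxs : x ∈ s := mem_ball_self (by linarith)
  -- all the eventual hypotheses at once
  have hall : ∀ᶠ k in atTop, (∀ y ∈ ball x δ, DifferentiableAt ℝ (f k) y) ∧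
      ContinuousOn (fun y => fderiv ℝ (f k) y) (ball x δ) ∧
      (∀ y ∈ ball x δ, ‖fderiv ℝ (f k) y‖ ≤ B) ∧
      ∀ y ∈ ball x δ, ∀ y' ∈ ball x δ,
        dist (fderiv ℝ (f k) y) (fderiv ℝ (f k) y') ≤ K * dist y y' ^ α :=
    (hdiff.and hcontd).and (hbd.and hmod) |>.mono fun k hk => ⟨hk.1.1, hk.1.2, hk.2.1, hk.2.2⟩
  /- ### the key step: along every sequence of indices tending to infinity there is a further
  subsequence along which the derivatives converge uniformly on `T` to the derivative of `g` -/
  have key : ∀ ns : ℕ → ℕ, Tendsto ns atTop atTop → ∃ ms : ℕ → ℕ,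
      HasFDerivAt g (fderiv ℝ g x) x ∧
      Tendsto (fun j => fderiv ℝ (f (ns (ms j))) x) atTop (𝓝 (fderiv ℝ g x)) := by
    intro ns hns
    -- drop an initial segment so that the hypotheses hold along the whole sequence
    obtain ⟨k₀, hk₀⟩ := (hns.eventually hall).exists_forall_of_atTop
    set ns' : ℕ → ℕ := fun k => ns (k + k₀) with hns'
    have hgood : ∀ k, (∀ y ∈ ball x δ, DifferentiableAt ℝ (f (ns' k)) y) ∧
        ContinuousOn (fun y => fderiv ℝ (f (ns' k)) y) (ball x δ) ∧
        (∀ y ∈ ball x δ, ‖fderiv ℝ (f (ns' k)) y‖ ≤ B) ∧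
        ∀ y ∈ ball x δ, ∀ y' ∈ ball x δ,
          dist (fderiv ℝ (f (ns' k)) y) (fderiv ℝ (f (ns' k)) y') ≤ K * dist y y' ^ α :=
      fun k => hk₀ (k + k₀) (Nat.le_add_left _ _)
    -- Arzelà–Ascoli for the normalised derivatives on the compact ball `T`
    set V : ℕ → EuclideanSpace ℝ (Fin 3) → (EuclideanSpace ℝ (Fin 3) →L[ℝ] EuclideanSpace ℝ (Fin 3)) :=
      fun k y => B'⁻¹ • fderiv ℝ (f (ns' k)) y with hV
    have hVprop : ∀ n : ℕ, ∀ᶠ k in atTop, ContinuousOn (V k) T ∧ (∀ z ∈ T, ‖V k z‖ ≤ 1) ∧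
        ∀ z ∈ T, ∀ z' ∈ T, dist (V k z) (V k z') ≤ K * dist z z' ^ α := by
      intro n
      refine Eventually.of_forall fun k => ⟨?_, ?_, ?_⟩
      · show ContinuousOn (fun y => B'⁻¹ • fderiv ℝ (f (ns' k)) y) T
        exact ((hgood k).2.1.mono hTδ).const_smul B'⁻¹
      · intro z hz
        show ‖B'⁻¹ • fderiv ℝ (f (ns' k)) z‖ ≤ 1
        rw [norm_smul, norm_inv, Real.norm_eq_abs, abs_of_pos hB'0]
        have h1 := (hgood k).2.2.1 z (hTδ hz)
        rw [inv_mul_le_iff₀ hB'0, mul_one]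
        exact h1.trans hBB'
      · intro z hz z' hz'
        have h1 := (hgood k).2.2.2 z (hTδ hz) z' (hTδ hz')
        have h2 : dist (V k z) (V k z') = B'⁻¹ * dist (fderiv ℝ (f (ns' k)) z) (fderiv ℝ (f (ns' k)) z') := by
          show dist (B'⁻¹ • fderiv ℝ (f (ns' k)) z) (B'⁻¹ • fderiv ℝ (f (ns' k)) z') = _
          have e1 : B'⁻¹ • fderiv ℝ (f (ns' k)) z - B'⁻¹ • fderiv ℝ (f (ns' k)) z' =
              B'⁻¹ • (fderiv ℝ (f (ns' k)) z - fderiv ℝ (f (ns' k)) z') :=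
            (smul_sub B'⁻¹ (fderiv ℝ (f (ns' k)) z) (fderiv ℝ (f (ns' k)) z')).symm
          rw [dist_eq_norm, e1, norm_smul, norm_inv, Real.norm_eq_abs, abs_of_pos hB'0,
            ← dist_eq_norm]
        rw [h2]
        have h3 : 0 ≤ K * dist z z' ^ α := mul_nonneg hK (Real.rpow_nonneg dist_nonneg _)
        calc B'⁻¹ * dist (fderiv ℝ (f (ns' k)) z) (fderiv ℝ (f (ns' k)) z')
            ≤ B'⁻¹ * (K * dist z z' ^ α) := mul_le_mul_of_nonneg_left h1 (inv_nonneg.2 hB'0.le)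
          _ ≤ 1 * (K * dist z z' ^ α) :=
              mul_le_mul_of_nonneg_right (inv_le_one_of_one_le₀ hB'1) h3
          _ = K * dist z z' ^ α := one_mul _
    obtain ⟨ms, hms, G, hG⟩ := exists_strictMono_tendstoUniformlyOn (T := fun _ : ℕ => T)
      (fun _ => isCompact_closedBall x (δ / 2)) (K := fun _ => K) (α := fun _ => α)
      (fun _ => hK) (fun _ => hα) hVprop
    have hG0 := hG 0
    -- the derivatives themselves converge uniformly to `B' • G`
    have hunif : TendstoUniformlyOn (fun j y => fderiv ℝ (f (ns' (ms j))) y) (fun y => B' • G y)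
        atTop s := by
      refine (Metric.tendstoUniformlyOn_iff.2 fun ε hε => ?_).mono hsT
      have h1 := Metric.tendstoUniformlyOn_iff.1 hG0 (ε / B') (div_pos hε hB'0)
      filter_upwards [h1] with j hj y hy
      have h2 := hj y hy
      have e : fderiv ℝ (f (ns' (ms j))) y = B' • V (ms j) y := by
        show fderiv ℝ (f (ns' (ms j))) y = B' • (B'⁻¹ • fderiv ℝ (f (ns' (ms j))) y)
        rw [smul_smul, mul_inv_cancel₀ hB'0.ne', one_smul]
      have e1 : B' • G y - B' • V (ms j) y = B' • (G y - V (ms j) y) :=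
        (smul_sub B' (G y) (V (ms j) y)).symm
      rw [e, dist_eq_norm, e1, norm_smul, Real.norm_eq_abs, abs_of_pos hB'0, ← dist_eq_norm]
      rwa [lt_div_iff₀' hB'0] at h2
    -- the uniform limit of the derivatives is the derivative of the limit
    have hderiv : ∀ j, ∀ y ∈ s, HasFDerivAt (f (ns' (ms j))) (fderiv ℝ (f (ns' (ms j))) y) y :=
      fun j y hy => ((hgood (ms j)).1 y (hTδ (hsT hy))).hasFDerivAt
    have hptw : ∀ y ∈ s, Tendsto (fun j => f (ns' (ms j)) y) atTop (𝓝 (g y)) := by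
      intro y hy
      have h1 : Tendsto (fun j => ns' (ms j)) atTop atTop :=
        (hns.comp (tendsto_add_atTop_nat k₀)).comp hms.tendsto_atTop
      exact (hlim y (hTδ (hsT hy))).comp h1
    have hHas : HasFDerivAt g (B' • G x) x :=
      hasFDerivAt_of_tendstoUniformlyOn isOpen_ball hunif hderiv hptw hxs
    have hfd : fderiv ℝ g x = B' • G x := hHas.fderiv
    refine ⟨fun j => ms j + k₀, ?_, ?_⟩
    · rw [hfd]; exact hHas
    · rw [hfd]
      exact hunif.tendsto_at hxs
  obtain ⟨-, hid⟩ := key id tendsto_id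
  refine ⟨(key id tendsto_id).choose_spec.1, ?_⟩
  exact tendsto_of_subseq_tendsto fun ns hns => by
    obtain ⟨ms, -, hms⟩ := key ns hns
    exact ⟨ms, hms⟩

end HardyAncientLimit

end Summit.NavierStokesRegularity.NavierStokesRegularity.Theorems

end
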